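import Literature.AlgebraicGeometry.AbelianVarieties.FourierMukaiExchangeTranslation
import HarnessLib

/-!
# Discharge of the named fact `Mukai1981_exchangeTranslation` (Mukai 1981 (3.1), first row, module level)

Layer `Literature/AlgebraicGeometry/AbelianVarieties`. The named fact
`AbelianVarieties/PoincareSheafOfPrincipal.Mukai1981_exchangeTranslation` — for a principally polarised complex abelian
variety `(A, Θ)` with dual `Â = A.dualOf Θ hΘ`, Poincaré sheaf `𝒫`, Mukai's (underived) functor
`Ŝ(M) = p_{Â*}(𝒫 ⊗ p_A^*M)` and every complex point `x` of `A` and every `𝒪_A`-module `M`,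
`Ŝ(t_x^*M) ≅ Ŝ(M) ⊗ P_{x⁻¹}` (`P_{x⁻¹} = 𝒫|_{{x⁻¹} × Â} = linePtHat A hΘ hK x⁻¹`; Mukai, §3 p. 158, the module-level row
behind (3.1); Lange Prop. 6.1.16 (b)) — is PROVED, literally as typed, by composing MODULE-LEVEL constructions already in the
tree (their `D⁺`-level composite is `FourierMukaiExchangeTranslation.fourierMukaiPlusExchangeTranslationIso`, which left the
displayed module-level row "neither used nor discharged"):

* the exchange isomorphism of KERNEL functors on all of `Mod(𝒪_A)`,
  `𝒫 ⊗ p_A^*(t_x^*M) ≅ (t_x × 1)^*(p_Â^*P_{x⁻¹} ⊗ (𝒫 ⊗ p_A^*M))` (`kernelExchangeTranslationNatIso`);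
* `(t_x × 1)^* ≅ ((t_x × 1)⁻¹)_*` (`Modules/DerivedPushforwardIsoBaseChange.pullbackIsoPushforwardInv`), composition of direct
  images (Mathlib `Scheme.Modules.pushforwardComp`, `pushforwardCongr`) and `(t_x × 1)⁻¹ ≫ p_Â = p_Â`
  (`snd_comp_refl_hom`): `p_{Â*}((t_x × 1)^*Z) ≅ p_{Â*}Z`;
* the module-level PROJECTION FORMULA for the line bundle `P_{x⁻¹}` and an ARBITRARY module,
  `p_{Â*}(p_Â^*P_{x⁻¹} ⊗ N) ≅ P_{x⁻¹} ⊗ p_{Â*}N` (`Modules/ProjectionFormulaLocallyFree.projectionFormulaIso`);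
* the braiding `P_{x⁻¹} ⊗ Ŝ(M) ≅ Ŝ(M) ⊗ P_{x⁻¹}` (`Modules/TensorBraiding.tensorComm`).

One theorem, no definitions, no instances; no consumer of the fact is edited.

## References

* S. Mukai, *Duality between `D(X)` and `D(X̂)` with its application to Picard sheaves*, Nagoya Math. J. 81 (1981), §3
  p. 158 L6–9 and (3.1). [Mukai1981]
* H. Lange, *Abelian Varieties over the Complex Numbers* (2023), Prop. 6.1.16 (b). [Lange2023AbelianVarietiesComplex]
* R. Hartshorne, *Algebraic Geometry* (1977), II Ex. 5.1 (d) (projection formula). [Hartshorne1977]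
-/

noncomputable section

-- `TopCat.Presheaf`/`Scheme.Modules` are not reducible (as in Mathlib's `AlgebraicGeometry/Modules/Sheaf.lean`).
set_option backward.isDefEq.respectTransparency false

open CategoryTheory CategoryTheory.Limits AlgebraicGeometry MonoidalCategory CartesianMonoidalCategory
open AlgebraicGeometry.Scheme.Modules

namespace Literature.AlgebraicGeometry.AbelianVarieties

open Literature.AlgebraicGeometry.Motives Literature.AlgebraicGeometry.Modules
open scoped MonObj

/-- **Mukai 1981 (3.1), first row, module level, holds: `Ŝ(t_x^*M) ≅ Ŝ(M) ⊗ P_{x⁻¹}`** for every complex point `x` of a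
principally polarised complex abelian variety `A` and every `𝒪_A`-module `M` — the named fact `Mukai1981_exchangeTranslation`,
discharged by composing the kernel exchange `kernelExchangeTranslationNatIso`, `(t_x × 1)^* ≅ ((t_x × 1)⁻¹)_*` with
`(t_x × 1)⁻¹ ≫ p_Â = p_Â`, the projection formula for `P_{x⁻¹}`, and the braiding.
[cite: Mukai1981, §3 p. 158 L6–9 and (3.1)] [cite: Lange2023AbelianVarietiesComplex, Prop. 6.1.16 (b)] -/
theorem Mukai1981_exchangeTranslation_holds : Mukai1981_exchangeTranslation := by
  intro A Θ hΘ hK x M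
  let Ah := A.dualOf Θ hΘ
  let p := (fst A.X Ah.X).left
  let q := (snd A.X Ah.X).left
  let e := translationProdUnitIso A hΘ x
  let Pc := poincareSheaf A hΘ hK
  let L := linePtHat A hΘ hK x⁻¹
  have hL : IsFiniteLocallyFree L := isFiniteLocallyFree_linePtHat A hΘ hK x⁻¹
  let K := integralKernelFunctor p Pc
  let T := (tensorBifunctor (A.X ⊗ Ah.X).left).obj ((Scheme.Modules.pullback q).obj L)
  -- `t_x` in the two spellings
  have ht : (A.translation x).left = (translationSchemeIso A x).hom := rfl
  -- `(t_x × 1)⁻¹ ≫ p_Â = p_Â`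
  have h : e.hom ≫ q = q := by
    simpa only [Iso.refl_hom, Category.comp_id] using (snd_comp_refl_hom A hΘ x).symm
  have w : e.inv ≫ q = q := by
    calc e.inv ≫ q = e.inv ≫ e.hom ≫ q := by rw [h]
      _ = q := by rw [Iso.inv_hom_id_assoc]
  -- Step 1: the kernel exchange at `M`: `𝒫 ⊗ p^*(t_x^*M) ≅ e^*(T(K M))`
  let i₁ : K.obj ((Scheme.Modules.pullback (translationSchemeIso A x).hom).obj M) ≅
      (Scheme.Modules.pullback e.hom).obj (T.obj (K.obj M)) :=
    (kernelExchangeTranslationNatIso A hΘ hK x).app M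
  -- Step 2: `q_*(e^* Z) ≅ q_*((e⁻¹)_* Z) ≅ (e⁻¹ ≫ q)_* Z ≅ q_* Z`
  let i₂ : Scheme.Modules.pullback e.hom ⋙ pushforward q ≅ pushforward q :=
    Functor.isoWhiskerRight (pullbackIsoPushforwardInv e) (pushforward q) ≪≫
      Scheme.Modules.pushforwardComp e.inv q ≪≫ Scheme.Modules.pushforwardCongr w
  -- Step 3: the projection formula `q_*(q^*L ⊗ N) ≅ L ⊗ q_*N` at `N = K M`, and the braiding
  let i₃ : (pushforward q).obj (T.obj (K.obj M)) ≅ tensorObj L ((pushforward q).obj (K.obj M)) :=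
    projectionFormulaIso q hL (K.obj M)
  let i₄ : tensorObj L ((pushforward q).obj (K.obj M)) ≅ tensorObj ((pushforward q).obj (K.obj M)) L :=
    tensorComm L _
  refine ⟨?_⟩
  rw [ht]
  exact (pushforward q).mapIso i₁ ≪≫ i₂.app (T.obj (K.obj M)) ≪≫ i₃ ≪≫ i₄

end Literature.AlgebraicGeometry.AbelianVarieties

end
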